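import Mathlib
import HarnessLib
import Summits.Ventures.LatticeQCDFlow.Exactness.NCMCGeneralSpaceMarkovRun

/-!
# Along an ergodic restart chain the engine's `ess` and `reweight` columns are strongly consistent too

HONEST FRAMING: exact (Metropolis-corrected) sampling algorithms for lattice gauge theory;
figures of merit are autocorrelation/cost numbers at stated couplings and volumes; no
continuum-physics claim.

Venture `LatticeQCDFlow` (cell pub-lqcd), topic `Exactness`; FANOUT row 13 (`eng-snf`, GEN-16).
NEW WORK of the cell, not a published result; no definition is introduced; nothing is cited as a
fact.  `NCMCGeneralSpaceMarkovRun.lean` wrote the `ΔF̂` statement for the engine's restart chain of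
forward records (kernel `(κF ∘ₖ K).comap s`, invariant law `P_F`); this file writes the two other
point estimates of the Jarzynski / reweighting lane for the same chain, under the same ergodicity
hypothesis `hErg` (discharged for irreducible / Doeblin-minorised / heat-bath level samplers in
`NCMCGeneralSpaceMarkovErgodicCriteria.lean` and its successors).

## Content (Crooks pair, `ν₀`-invariant Markov level sampler `K`, restart chain started in `P_F`,
## `hErg`: the chain is shift-ergodic)

* **`CrooksPair.tendsto_essHat_ae_restartChain`** — with `e^{−W} ∈ L²(P_F)`: the Kish fraction of
  the weights `e^{−W_i}` read along the chain converges a.s. to `ESS_F = (E_F e^{−W})²/E_F e^{−2W}`.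
* **`CrooksPair.tendsto_reweighted_ae_restartChain`** — for measurable `f` with
  `e^{−W} f(end) ∈ L¹(P_F)`: `Σ_{i<n} e^{−W_i} f(end_i) / Σ_{i<n} e^{−W_i} → (ν₁ Ω)⁻¹ ∫ f dν₁` a.s.

NOT CLAIMED: error bars; the BAR root along two chains (see `NCMCGeneralSpaceMarkovErgodicPairs`).
-/

namespace Summit.Ventures.LatticeQCDFlow.Exactness.GeneralNCMC

open MeasureTheory ProbabilityTheory Set Filter Finset
open scoped ENNReal Topology

namespace CrooksPair

variable {Ω E : Type*} [MeasurableSpace Ω] [MeasurableSpace E]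
variable {ν₀ ν₁ : Measure Ω} {κF κR : Kernel Ω E} {s e : E → Ω} {W : E → ℝ}

/-- **The `ess` column along an ergodic restart chain**: the Kish fraction of the weights converges
almost surely to the population `ESS_F = (E_F e^{−W})² / E_F e^{−2W}`. -/
theorem tendsto_essHat_ae_restartChain (K : Kernel Ω Ω) [IsMarkovKernel K] [IsFiniteMeasure ν₀]
    [IsMarkovKernel κF] (h0 : ν₀ univ ≠ 0) (hK : Kernel.Invariant K ν₀)
    (h : CrooksPair ν₀ ν₁ κF κR s e W)
    (hL2 : MemLp (fun ε => Real.exp (-W ε)) 2 (fwdPathLaw ν₀ κF))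
    (hErg : haveI := isProbabilityMeasure_fwdPathLaw ν₀ h0 κF
      Ergodic (fun (x : ℕ → E) (k : ℕ) => x (k + 1))
        (Kernel.trajMeasure (X := fun _ : ℕ => E) (fwdPathLaw ν₀ κF)
          (fun n : ℕ => ((κF ∘ₖ K).comap s h.measurable_s).comap
            (fun hh : (j : ↥(Finset.Iic n)) → E => hh ⟨n, Finset.mem_Iic.2 le_rfl⟩)
            (measurable_pi_apply _)))) :
    haveI := isProbabilityMeasure_fwdPathLaw ν₀ h0 κF
    ∀ᵐ x ∂(Kernel.trajMeasure (X := fun _ : ℕ => E) (fwdPathLaw ν₀ κF)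
        (fun n : ℕ => ((κF ∘ₖ K).comap s h.measurable_s).comap
          (fun hh : (j : ↥(Finset.Iic n)) → E => hh ⟨n, Finset.mem_Iic.2 le_rfl⟩)
          (measurable_pi_apply _))),
      Tendsto (fun n : ℕ => essHat (fun i : Fin n => Real.exp (-W (x i)))) atTop
        (𝓝 ((∫ ε, Real.exp (-W ε) ∂(fwdPathLaw ν₀ κF)) ^ 2 /
          ∫ ε, Real.exp (-(2 * W ε)) ∂(fwdPathLaw ν₀ κF))) := by
  haveI := isProbabilityMeasure_fwdPathLaw ν₀ h0 κF
  have hsq_form : ∫ ε, Real.exp (-W ε) ^ 2 ∂(fwdPathLaw ν₀ κF) =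
      ∫ ε, Real.exp (-(2 * W ε)) ∂(fwdPathLaw ν₀ κF) := by
    refine integral_congr_ae (Eventually.of_forall fun ε => ?_)
    simp only
    rw [sq, ← Real.exp_add]
    congr 1
    ring
  have hint2 : Integrable (fun ε => Real.exp (-(2 * W ε))) (fwdPathLaw ν₀ κF) := by
    refine hL2.integrable_sq.congr (Eventually.of_forall fun ε => ?_)
    simp only
    rw [sq, ← Real.exp_add]
    congr 1
    ring
  have hsq : ∫ ε, Real.exp (-W ε) ^ 2 ∂(fwdPathLaw ν₀ κF) ≠ 0 := by
    rw [hsq_form]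
    exact (integral_exp_pos hint2).ne'
  have key := GeneralNCMC.tendsto_essHat_ae_of_ergodic hErg (h.restartChain_map_eval K h0 hK 0)
    (w := fun ε => Real.exp (-W ε)) hL2 hsq
  rw [hsq_form] at key
  exact key

/-- **The `reweight` column along an ergodic restart chain**: self-normalised reweighted end-point
observables converge almost surely to their TARGET means. -/
theorem tendsto_reweighted_ae_restartChain (K : Kernel Ω Ω) [IsMarkovKernel K] [IsFiniteMeasure ν₀]
    [IsFiniteMeasure ν₁] [IsMarkovKernel κF] [IsMarkovKernel κR] (h0 : ν₀ univ ≠ 0)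
    (h1 : ν₁ univ ≠ 0) (hK : Kernel.Invariant K ν₀) (h : CrooksPair ν₀ ν₁ κF κR s e W)
    {f : Ω → ℝ} (hfm : Measurable f)
    (hA : Integrable (fun ε => Real.exp (-W ε) * f (e ε)) (fwdPathLaw ν₀ κF))
    (hErg : haveI := isProbabilityMeasure_fwdPathLaw ν₀ h0 κF
      Ergodic (fun (x : ℕ → E) (k : ℕ) => x (k + 1))
        (Kernel.trajMeasure (X := fun _ : ℕ => E) (fwdPathLaw ν₀ κF)
          (fun n : ℕ => ((κF ∘ₖ K).comap s h.measurable_s).comap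
            (fun hh : (j : ↥(Finset.Iic n)) → E => hh ⟨n, Finset.mem_Iic.2 le_rfl⟩)
            (measurable_pi_apply _)))) :
    haveI := isProbabilityMeasure_fwdPathLaw ν₀ h0 κF
    ∀ᵐ x ∂(Kernel.trajMeasure (X := fun _ : ℕ => E) (fwdPathLaw ν₀ κF)
        (fun n : ℕ => ((κF ∘ₖ K).comap s h.measurable_s).comap
          (fun hh : (j : ↥(Finset.Iic n)) → E => hh ⟨n, Finset.mem_Iic.2 le_rfl⟩)
          (measurable_pi_apply _))),
      Tendsto (fun n : ℕ => (∑ i ∈ range n, Real.exp (-W (x i)) * f (e (x i))) /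
        ∑ i ∈ range n, Real.exp (-W (x i))) atTop (𝓝 (((ν₁ univ)⁻¹).toReal * ∫ y, f y ∂ν₁)) := by
  haveI := isProbabilityMeasure_fwdPathLaw ν₀ h0 κF
  exact h.tendsto_reweighted_ae_of_ergodic h0 h1 hfm hA hErg (h.restartChain_map_eval K h0 hK 0)

end CrooksPair

end Summit.Ventures.LatticeQCDFlow.Exactness.GeneralNCMC
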